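import Mathlib
import Summits.KontsevichZagierPeriods.Zeta5Search.BrickTopFrobenius
import Summits.KontsevichZagierPeriods.Zeta5Search.BrickPhiTaylor

/-!
# BrickLaurent — the partial-fraction cells `c_{K,s}(n)` of the brick kernel as Taylor coefficients, and the
one-step Frobenius comparison (B1) at EVERY depth (cell zeta5-irr)

HONEST FRAMING: systematic search; no irrationality claim unless certified. INSTRUMENT lemma of the ζ(5)
census cell zeta5-irr (HOME `run/shared/lean/pub/zeta5-irr/`; memo `zi-p2/LEMMAS.md` §B8-a″ THEOREMS 5/6/7,
`zi-p2/probes/B8/thm6/THEOREM6.md` §0 «`R_n(t) = Σ_{K=0}^{n}Σ_{s=1}^{A}c_{K,s}(n)(t+K)^{−s}`» and Step B «(B1)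
`p^{τ_s}c_{jp,s}(np) = Σ_{m=0}^{A−s}φ_m·c_{j,s+m}(n)`»; design note HOME `zi-eng/lean-g8/DESIGN-CELLS.md`).
Nothing here is about ζ(5); no irrationality content; filing moves no rung. Filed by the engine seat zi-eng (g8);
sequel of `BrickTopCoefficient` / `BrickTopFrobenius` (zi-eng g7: the depth-0 case) and `BrickPhiTaylor`.

## Objects

* GENERIC. For a field `k`, `a ∈ k` and `P, Q ∈ k[X]`: `expandAt a P Q := taylor_a(P)·taylor_a(Q)⁻¹ ∈ k⟦X⟧`, the
  Taylor series of `P/Q` at `a` in the variable `X = t − a` (Mathlib `Polynomial.taylor`, the `k⟦X⟧`-inverse; it is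
  THE expansion when `Q(a) ≠ 0`): `coeff_zero_expandAt` (`= P(a)/Q(a)`), `expandAt_mul`, `expandAt_eq_of_mul_eq`
  (`P₁Q₂ = P₂Q₁ ⇒` equal series), `coe_comp_C_mul_X` (`T ↦ cT` is `PowerSeries.rescale c`), `rescale_inv`.
* THE KERNEL AS A QUOTIENT OF POLYNOMIALS in `t`: `kerNum A B ε n = n!^{A−2B}(X + n/2)^ε∏_{m=1}^{n}(X−m)^B∏_{m=1}^{n}(X+n+m)^B`,
  `kerDen A n = ∏_{m=0}^{n}(X+m)^A`, `kerDenErase A n K = ∏_{m≤n, m≠K}(X+m)^A`, with `brickKernel A B ε n t =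
  kerNum(t)/kerDen(t)` and `BrickTopCoefficient.topFun A B ε n K t = kerNum(t)/kerDenErase_K(t)` for every `t`.
* `laurentSeries A B ε n K := expandAt (−K) kerNum kerDenErase_K` — zi-p2's `F_K(T) = T^A·R_n(−K+T)` (THEOREM 5
  Step C) as a formal power series; `laurent A B ε n K d := [T^d]` of it = the coefficient of `(t+K)^{d−A}` in the
  Laurent expansion of `R_n` at `−K`; **`cell A B ε n K s := laurent A B ε n K (A − s)` = zi-p2's `c_{K,s}(n)`**
  (`1 ≤ s ≤ A`; the symmetric kernel's `c̃_{k,s}(m)` is the case `ε = 0`). No normalisation `p^{τ_s}` is built in.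
* `phiSeries A B p n K := expandAt 0 N D` for `BrickPhiTaylor`'s `N = phiNum`, `D = phiDen ∈ ℤ[T]`
  (`Φ_{n,p}(−K+T) = N(T)/D(T)`), `phiCoeff … m = φ_m`; `phiCoeff_zero`: `φ_0 = Φ_{n,p}(−K)`.

## What is PROVED (everything; standard axioms)

* `laurent_zero`: `laurent A B ε n K 0 = cTop A B ε n K` (`2B ≤ A`, `K ≤ n`) — the depth-0 cell is g7's closed form.
* **`laurentSeries_frobenius`** (odd prime `p`, `2B ≤ A`, `K ≤ n`): `rescale_p(F^{(np)}_{Kp}) = p^ε·Φ-series·F^{(n)}_K`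
  in `ℚ⟦T⟧` — from g7's product identity `topFun_frobenius` (all `t`) ⇒ polynomials (infinitely many values) ⇒ series.
* **`laurent_frobenius` = (B1) at every depth `d`**: `p^d·laurent(np, Kp, d) = p^ε·Σ_{m+e=d} φ_m·laurent(n, K, e)`;
  **`cell_frobenius`** (s-form, `1 ≤ s ≤ A`): `p^{A−s}·c_{Kp,s}(np) = p^ε·Σ_{m=0}^{A−s} φ_m·c_{K,s+m}(n)` — for `ε = 1`
  this is zi-p2's (B1) `p^{τ_s}c_{jp,s}(np) = Σ_m φ_m c_{j,s+m}(n)`, `τ_s = A − 1 − s`, now for ALL `s` (g7 had `s = A`).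
* TRUNCATION `X_sub_C_pow_dvd` (generic): `(X − a)^N ∣ P − Q·Σ_{d<N}[T^d](expandAt a P Q)·(X − a)^d` (`Q(a) ≠ 0`).
-/

namespace Summit.KontsevichZagierPeriods.Zeta5Search.BrickLaurent

open Finset Nat Polynomial
open Summit.KontsevichZagierPeriods.Zeta5Search.BrickKernelFrobenius (brickKernel brickPhi)
open Summit.KontsevichZagierPeriods.Zeta5Search.BrickTopCoefficient (topFun cTop topFun_neg_natCast)
open Summit.KontsevichZagierPeriods.Zeta5Search.BrickTopFrobenius (topFun_frobenius)
open Summit.KontsevichZagierPeriods.Zeta5Search.BrickPhiTaylor (phiNum phiDen brickPhi_neg_add_eq)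

noncomputable section
/-! ## Generic: the Taylor series of a quotient of polynomials at a point -/

section generic

variable {k : Type*} [Field k]

/-- The Taylor series of `P/Q` at `a`, in the variable `X = t − a`: `taylor_a(P) · taylor_a(Q)⁻¹ ∈ k⟦X⟧`
(the expansion of the rational function `P/Q` when `Q(a) ≠ 0`; if `Q(a) = 0` the `k⟦X⟧`-inverse is `0`). -/
def expandAt (a : k) (P Q : k[X]) : PowerSeries k :=
  ((taylor a P : k[X]) : PowerSeries k) * (((taylor a Q : k[X]) : PowerSeries k))⁻¹

/-- The constant coefficient of `taylor_a(Q)` is `Q(a)`. -/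
theorem constantCoeff_coe_taylor (a : k) (Q : k[X]) :
    PowerSeries.constantCoeff ((taylor a Q : k[X]) : PowerSeries k) = Q.eval a := by
  rw [Polynomial.constantCoeff_coe, taylor_coeff_zero]

/-- `[X^0] expandAt a P Q = P(a)/Q(a)`. -/
theorem coeff_zero_expandAt (a : k) (P Q : k[X]) :
    PowerSeries.coeff 0 (expandAt a P Q) = P.eval a / Q.eval a := by
  rw [expandAt, PowerSeries.coeff_zero_eq_constantCoeff_apply, map_mul, PowerSeries.constantCoeff_inv,
    constantCoeff_coe_taylor, constantCoeff_coe_taylor, div_eq_mul_inv]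

/-- Multiplicativity: `expandAt a (P₁P₂) (Q₁Q₂) = expandAt a P₁ Q₁ · expandAt a P₂ Q₂`. -/
theorem expandAt_mul (a : k) (P₁ Q₁ P₂ Q₂ : k[X]) :
    expandAt a (P₁ * P₂) (Q₁ * Q₂) = expandAt a P₁ Q₁ * expandAt a P₂ Q₂ := by
  unfold expandAt
  rw [taylor_mul, taylor_mul, Polynomial.coe_mul, Polynomial.coe_mul, PowerSeries.mul_inv_rev]
  ring

/-- Well-definedness on fractions: `P₁Q₂ = P₂Q₁` with `Q₁(a), Q₂(a) ≠ 0` gives `expandAt a P₁ Q₁ = expandAt a P₂ Q₂`. -/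
theorem expandAt_eq_of_mul_eq (a : k) {P₁ Q₁ P₂ Q₂ : k[X]} (h : P₁ * Q₂ = P₂ * Q₁) (h₁ : Q₁.eval a ≠ 0)
    (h₂ : Q₂.eval a ≠ 0) : expandAt a P₁ Q₁ = expandAt a P₂ Q₂ := by
  unfold expandAt
  have hc₁ : PowerSeries.constantCoeff ((taylor a Q₁ : k[X]) : PowerSeries k) ≠ 0 := by
    rwa [constantCoeff_coe_taylor]
  have hc₂ : PowerSeries.constantCoeff ((taylor a Q₂ : k[X]) : PowerSeries k) ≠ 0 := by
    rwa [constantCoeff_coe_taylor]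
  rw [PowerSeries.eq_mul_inv_iff_mul_eq hc₂]
  have h' : ((taylor a P₁ : k[X]) : PowerSeries k) * ((taylor a Q₂ : k[X]) : PowerSeries k) =
      ((taylor a P₂ : k[X]) : PowerSeries k) * ((taylor a Q₁ : k[X]) : PowerSeries k) := by
    rw [← Polynomial.coe_mul, ← Polynomial.coe_mul, ← taylor_mul, ← taylor_mul, h]
  calc ((taylor a P₁ : k[X]) : PowerSeries k) * (((taylor a Q₁ : k[X]) : PowerSeries k))⁻¹ *
        ((taylor a Q₂ : k[X]) : PowerSeries k)
      = ((taylor a P₁ : k[X]) : PowerSeries k) * ((taylor a Q₂ : k[X]) : PowerSeries k) *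
          (((taylor a Q₁ : k[X]) : PowerSeries k))⁻¹ := by ring
    _ = ((taylor a P₂ : k[X]) : PowerSeries k) *
          (((taylor a Q₁ : k[X]) : PowerSeries k) * (((taylor a Q₁ : k[X]) : PowerSeries k))⁻¹) := by
        rw [h']; ring
    _ = ((taylor a P₂ : k[X]) : PowerSeries k) := by rw [PowerSeries.mul_inv_cancel _ hc₁, mul_one]

/-- The substitution `T ↦ c·T` on polynomials is `PowerSeries.rescale c` on their power series. -/
theorem coe_comp_C_mul_X (c : k) (P : k[X]) :
    ((P.comp (C c * X) : k[X]) : PowerSeries k) = PowerSeries.rescale c (P : PowerSeries k) := by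
  have h : (Polynomial.coeToPowerSeries.ringHom (R := k)).comp (compRingHom (C c * X)) =
      (PowerSeries.rescale c).comp Polynomial.coeToPowerSeries.ringHom := by
    refine Polynomial.ringHom_ext (fun b => ?_) ?_
    · simp only [RingHom.comp_apply, coe_compRingHom, C_comp, Polynomial.coeToPowerSeries.ringHom_apply,
        Polynomial.coe_C]
      ext m
      rw [PowerSeries.coeff_rescale, PowerSeries.coeff_C]
      split_ifs with hm
      · rw [hm, pow_zero, one_mul]
      · rw [mul_zero]
    · simp only [RingHom.comp_apply, coe_compRingHom, X_comp, Polynomial.coeToPowerSeries.ringHom_apply,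
        Polynomial.coe_mul, Polynomial.coe_C, Polynomial.coe_X, PowerSeries.rescale_X]
  have := congrArg (fun f => f P) h
  simpa only [RingHom.comp_apply, coe_compRingHom, Polynomial.coeToPowerSeries.ringHom_apply] using this

/-- `rescale` commutes with the `k⟦X⟧`-inverse (at an invertible series). -/
theorem rescale_inv (c : k) {f : PowerSeries k} (h : PowerSeries.constantCoeff f ≠ 0) :
    PowerSeries.rescale c f⁻¹ = (PowerSeries.rescale c f)⁻¹ := by
  have hc : PowerSeries.constantCoeff (PowerSeries.rescale c f) ≠ 0 := by
    rwa [← PowerSeries.coeff_zero_eq_constantCoeff_apply, PowerSeries.coeff_rescale, pow_zero, one_mul,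
      PowerSeries.coeff_zero_eq_constantCoeff_apply]
  rw [PowerSeries.eq_inv_iff_mul_eq_one hc, ← map_mul, PowerSeries.inv_mul_cancel _ h, map_one]

/-- **TRUNCATION.** If `Q(a) ≠ 0` then `(X − a)^N ∣ P − Q·Σ_{d<N}[T^d](expandAt a P Q)·(X − a)^d` in `k[X]`: the
partial sums of the Taylor series of `P/Q` at `a` approximate `P/Q` to order `N`. -/
theorem X_sub_C_pow_dvd (a : k) (P Q : k[X]) (hQ : Q.eval a ≠ 0) (N : ℕ) :
    (X - C a) ^ N ∣ P - Q * ∑ d ∈ range N, C (PowerSeries.coeff d (expandAt a P Q)) * (X - C a) ^ d := by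
  set E := expandAt a P Q with hE
  -- after `taylor a` the claim is `X^N ∣ taylor_a P − taylor_a Q · Σ_{d<N} [T^d]E · X^d`
  set S : k[X] := ∑ d ∈ range N, C (PowerSeries.coeff d E) * X ^ d with hS
  have hc : PowerSeries.constantCoeff ((taylor a Q : k[X]) : PowerSeries k) ≠ 0 := by
    rwa [constantCoeff_coe_taylor]
  have hXN : (X : k[X]) ^ N ∣ taylor a P - taylor a Q * S := by
    rw [Polynomial.X_pow_dvd_iff]
    intro d hd
    -- in `k⟦X⟧`: `taylor_a P = taylor_a Q · E` and `E − S ≡ 0 (mod X^N)`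
    have hPS : ((taylor a P - taylor a Q * S : k[X]) : PowerSeries k) =
        ((taylor a Q : k[X]) : PowerSeries k) * (E - (S : PowerSeries k)) := by
      rw [mul_sub, hE, expandAt, mul_comm ((taylor a P : k[X]) : PowerSeries k), ← mul_assoc,
        PowerSeries.mul_inv_cancel _ hc, one_mul]
      simp only [← Polynomial.coeToPowerSeries.ringHom_apply, map_sub, map_mul]
    have hdvd : (PowerSeries.X : PowerSeries k) ^ N ∣ E - (S : PowerSeries k) := by
      rw [PowerSeries.X_pow_dvd_iff]
      intro m hm
      rw [map_sub, hS, Polynomial.coeff_coe, Polynomial.finsetSum_coeff]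
      simp only [Polynomial.coeff_C_mul, Polynomial.coeff_X_pow, mul_ite, mul_one, mul_zero,
        Finset.sum_ite_eq, Finset.mem_range, if_pos hm, sub_self]
    obtain ⟨G, hG⟩ := hdvd
    rw [← Polynomial.coeff_coe, hPS, hG, ← mul_assoc, mul_comm _ ((PowerSeries.X : PowerSeries k) ^ N),
      mul_assoc, PowerSeries.coeff_X_pow_mul']
    rw [if_neg (by omega)]
  -- transport back along `taylor (−a)`
  have h2 := map_dvd (taylorAlgHom (-a) : k[X] →ₐ[k] k[X]) hXN
  have e1 : (taylorAlgHom (-a) : k[X] →ₐ[k] k[X]) ((X : k[X]) ^ N) = (X - C a) ^ N := by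
    show taylor (-a) ((X : k[X]) ^ N) = (X - C a) ^ N
    rw [taylor_X_pow, C_neg, ← sub_eq_add_neg]
  have e2 : (taylorAlgHom (-a) : k[X] →ₐ[k] k[X]) (taylor a P - taylor a Q * S) =
      P - Q * ∑ d ∈ range N, C (PowerSeries.coeff d E) * (X - C a) ^ d := by
    show taylor (-a) (taylor a P - taylor a Q * S) = _
    rw [map_sub, taylor_mul, taylor_taylor, taylor_taylor, neg_add_cancel, taylor_zero, taylor_zero, hS,
      map_sum]
    congr 1; congr 1
    refine Finset.sum_congr rfl fun d _ => ?_
    rw [taylor_mul, taylor_C, taylor_pow, taylor_X, C_neg, ← sub_eq_add_neg]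
  rwa [e1, e2] at h2

end generic

/-! ## The brick kernel and its regular parts as quotients of polynomials -/

/-- The numerator `n!^{A−2B}·(X + n/2)^ε·∏_{m=1}^{n}(X − m)^B·∏_{m=1}^{n}(X + n + m)^B ∈ ℚ[X]` of the brick kernel. -/
def kerNum (A B ε n : ℕ) : ℚ[X] :=
  C ((n ! : ℚ) ^ (A - 2 * B)) * (X + C ((n : ℚ) / 2)) ^ ε * (∏ m ∈ Icc 1 n, (X - C (m : ℚ))) ^ B *
    (∏ m ∈ Icc 1 n, (X + C (n : ℚ) + C (m : ℚ))) ^ B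

/-- The denominator `∏_{m=0}^{n}(X + m)^A` of the brick kernel. -/
def kerDen (A n : ℕ) : ℚ[X] := (∏ m ∈ range (n + 1), (X + C (m : ℚ))) ^ A

/-- The denominator with the pole `−K` removed: `∏_{m ≤ n, m ≠ K}(X + m)^A`. -/
def kerDenErase (A n K : ℕ) : ℚ[X] := (∏ m ∈ (range (n + 1)).erase K, (X + C (m : ℚ))) ^ A

/-- `kerNum(t) = n!^{A−2B}(t+n/2)^ε(∏_{m=1}^{n}(t−m))^B(∏_{m=1}^{n}(t+n+m))^B`. -/
theorem eval_kerNum (A B ε n : ℕ) (t : ℚ) : (kerNum A B ε n).eval t = (n ! : ℚ) ^ (A - 2 * B) *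
    (t + (n : ℚ) / 2) ^ ε * (∏ m ∈ Icc 1 n, (t - m)) ^ B * (∏ m ∈ Icc 1 n, (t + n + m)) ^ B := by
  simp only [kerNum, eval_mul, eval_pow, eval_C, eval_add, eval_sub, eval_X, eval_prod]

/-- `kerDen(t) = (∏_{m=0}^{n}(t+m))^A`. -/
theorem eval_kerDen (A n : ℕ) (t : ℚ) : (kerDen A n).eval t = (∏ m ∈ range (n + 1), (t + m)) ^ A := by
  simp only [kerDen, eval_pow, eval_prod, eval_add, eval_X, eval_C]

/-- `kerDenErase_K(t) = (∏_{m≤n, m≠K}(t+m))^A`. -/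
theorem eval_kerDenErase (A n K : ℕ) (t : ℚ) :
    (kerDenErase A n K).eval t = (∏ m ∈ (range (n + 1)).erase K, (t + m)) ^ A := by
  simp only [kerDenErase, eval_pow, eval_prod, eval_add, eval_X, eval_C]

/-- `R_n(t) = kerNum(t)/kerDen(t)` for every `t` (poles included, `x/0 = 0`). -/
theorem brickKernel_eq_div (A B ε n : ℕ) (t : ℚ) :
    brickKernel A B ε n t = (kerNum A B ε n).eval t / (kerDen A n).eval t := by
  rw [eval_kerNum, eval_kerDen]; rfl

/-- `g_K(t) = kerNum(t)/kerDenErase_K(t)` for every `t`. -/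
theorem topFun_eq_div (A B ε n K : ℕ) (t : ℚ) :
    topFun A B ε n K t = (kerNum A B ε n).eval t / (kerDenErase A n K).eval t := by
  rw [eval_kerNum, eval_kerDenErase]; rfl

/-- `kerDenErase_K(−K) ≠ 0`: the point `−K` is not a root of the other linear factors. -/
theorem eval_kerDenErase_neg_ne_zero (A n K : ℕ) : (kerDenErase A n K).eval (-(K : ℚ)) ≠ 0 := by
  rw [eval_kerDenErase]
  refine pow_ne_zero _ (Finset.prod_ne_zero_iff.2 fun m hm h => Finset.ne_of_mem_erase hm ?_)
  exact_mod_cast (by linarith : (m : ℚ) = K)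

/-! ## The Laurent coefficients (cells) -/

/-- **The Laurent series of the brick kernel at `−K`** as a power series in `T = t + K`:
`F_K(T) = T^A·R_n(−K+T) = g_K(−K+T)` expanded at `T = 0` (zi-p2 THEOREM 5 Step C's `F_j`). -/
def laurentSeries (A B ε n K : ℕ) : PowerSeries ℚ :=
  expandAt (-(K : ℚ)) (kerNum A B ε n) (kerDenErase A n K)

/-- `laurent A B ε n K d = [T^d]F_K(T)` = the coefficient of `(t+K)^{d−A}` in the Laurent expansion of `R_n` at
`−K` (`d` = depth below the top coefficient). -/
def laurent (A B ε n K d : ℕ) : ℚ := PowerSeries.coeff d (laurentSeries A B ε n K)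

/-- **zi-p2's partial-fraction cell `c_{K,s}(n)`** = the coefficient of `(t+K)^{−s}`, `1 ≤ s ≤ A`:
`cell A B ε n K s = laurent A B ε n K (A − s)`. -/
def cell (A B ε n K s : ℕ) : ℚ := laurent A B ε n K (A - s)

/-- `c_{K,s}(n) = [T^{A−s}]F_K(T)`. -/
theorem cell_eq (A B ε n K s : ℕ) : cell A B ε n K s = PowerSeries.coeff (A - s) (laurentSeries A B ε n K) := rfl
/-- **The depth-0 cell is the leading coefficient**: `laurent A B ε n K 0 = cTop A B ε n K` (`2B ≤ A`, `K ≤ n`), i.e.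
`c_{K,A}(n) = (−1)^{nB+KA}(n/2 − K)^ε C(n,K)^A[C(n+K,K)C(2n−K,n)]^B` (g7's `topFun_neg_natCast`). -/
theorem laurent_zero {A B : ℕ} (hAB : 2 * B ≤ A) (ε : ℕ) {n K : ℕ} (hK : K ≤ n) :
    laurent A B ε n K 0 = cTop A B ε n K := by
  rw [laurent, laurentSeries, coeff_zero_expandAt, ← topFun_eq_div, topFun_neg_natCast hAB ε hK]

/-- `c_{K,A}(n) = cTop A B ε n K` (`2B ≤ A`, `K ≤ n`). -/
theorem cell_top {A B : ℕ} (hAB : 2 * B ≤ A) (ε : ℕ) {n K : ℕ} (hK : K ≤ n) :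
    cell A B ε n K A = cTop A B ε n K := by
  rw [cell, Nat.sub_self, laurent_zero hAB ε hK]

/-! ## The Taylor coefficients `φ_m` of `Φ_{n,p}` at `−K` -/

/-- The Taylor series of `Φ_{n,p}(−K+T)` at `T = 0`, from `BrickPhiTaylor`'s `N(T)/D(T) ∈ ℤ[T]`. -/
def phiSeries (A B p n : ℕ) (K : ℤ) : PowerSeries ℚ :=
  expandAt 0 ((phiNum A B p n K).map (Int.castRingHom ℚ)) ((phiDen A p n K).map (Int.castRingHom ℚ))

/-- `φ_m = [T^m]Φ_{n,p}(−K+T)`. -/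
def phiCoeff (A B p n : ℕ) (K : ℤ) (m : ℕ) : ℚ := PowerSeries.coeff m (phiSeries A B p n K)

variable {p : ℕ}
/-- `aeval t P = (P.map ℤ→ℚ).eval t` for `P ∈ ℤ[X]`, `t ∈ ℚ`. [folklore] -/
theorem aeval_eq_eval_map (P : ℤ[X]) (t : ℚ) : aeval t P = (P.map (Int.castRingHom ℚ)).eval t := by
  rw [aeval_def, eval_map, algebraMap_int_eq]

/-- `D(0) = ∏_{p∤ℓ≤np}(ℓ − Kp)^A ≠ 0` (no factor vanishes: `ℓ = Kp` would be a multiple of `p`). -/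
theorem eval_phiDen_zero_ne_zero (A p n : ℕ) (K : ℤ) :
    ((phiDen A p n K).map (Int.castRingHom ℚ)).eval 0 ≠ 0 := by
  rw [← coeff_zero_eq_eval_zero, coeff_map, coeff_zero_eq_eval_zero, map_ne_zero_iff _ (RingHom.injective_int _),
    phiDen, eval_pow, eval_prod]
  refine pow_ne_zero _ (Finset.prod_ne_zero_iff.2 fun m hm h => (mem_filter.1 hm).2 ?_)
  simp only [eval_add, eval_mul, eval_C, eval_X, mul_zero, add_zero, sub_eq_zero] at h
  exact Int.natCast_dvd_natCast.1 ⟨K, by rw [h, mul_comm]⟩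

/-- `φ_0 = Φ_{n,p}(−K)` (odd prime `p`). -/
theorem phiCoeff_zero (hp : p.Prime) (h2 : p ≠ 2) (A B n : ℕ) (K : ℤ) :
    phiCoeff A B p n K 0 = brickPhi A B p n (-(K : ℚ)) := by
  rw [phiCoeff, phiSeries, coeff_zero_expandAt, ← aeval_eq_eval_map, ← aeval_eq_eval_map,
    ← brickPhi_neg_add_eq hp h2, add_zero]

/-! ## (B1): the one-step Frobenius comparison at every depth -/

section frobenius

variable (hp : p.Prime) (h2 : p ≠ 2) {A B : ℕ} (hAB : 2 * B ≤ A) (ε : ℕ) {n K : ℕ} (hK : K ≤ n)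
include hp h2 hAB hK

/-- The polynomial identity behind (B1): with `a = −Kp`, `L_N = taylor_a(kerNum_{np})(pT)`, `L_D =
taylor_a(kerDenErase_{np,Kp})(pT)`, `N/D = Φ_{n,p}(−K+T)` and `tN/tD = g_K(−K+T)`:
`L_N · D · tD = p^ε · L_D · N · tN` in `ℚ[T]` (from `topFun_frobenius` at `t = −K+T` for infinitely many `T`). -/
theorem frobenius_poly :
    (taylor (-((K * p : ℕ) : ℚ)) (kerNum A B ε (n * p))).comp (C (p : ℚ) * X) *
        (phiDen A p n K).map (Int.castRingHom ℚ) * taylor (-(K : ℚ)) (kerDenErase A n K) =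
      C ((p : ℚ) ^ ε) * (taylor (-((K * p : ℕ) : ℚ)) (kerDenErase A (n * p) (K * p))).comp (C (p : ℚ) * X) *
        (phiNum A B p n K).map (Int.castRingHom ℚ) * taylor (-(K : ℚ)) (kerNum A B ε n) := by
  set LD := (taylor (-((K * p : ℕ) : ℚ)) (kerDenErase A (n * p) (K * p))).comp (C (p : ℚ) * X) with hLD
  set PD := (phiDen A p n K).map (Int.castRingHom ℚ) with hPD
  set tD := taylor (-(K : ℚ)) (kerDenErase A n K) with htD
  have hpQ : (p : ℚ) ≠ 0 := by exact_mod_cast hp.ne_zero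
  -- the three denominators do not vanish at `T = 0`, so their product is a nonzero polynomial
  have hG : LD * PD * tD ≠ 0 := by
    intro h
    have h0 := congrArg (eval (0 : ℚ)) h
    rw [eval_mul, eval_mul, eval_zero] at h0
    rcases mul_eq_zero.1 h0 with h0 | h0
    · rcases mul_eq_zero.1 h0 with h0 | h0
      · rw [hLD, eval_comp, eval_mul, eval_C, eval_X, mul_zero, taylor_eval, zero_add] at h0
        exact eval_kerDenErase_neg_ne_zero A (n * p) (K * p) h0
      · exact eval_phiDen_zero_ne_zero A p n K h0
    · rw [htD, taylor_eval, zero_add] at h0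
      exact eval_kerDenErase_neg_ne_zero A n K h0
  apply Polynomial.eq_of_infinite_eval_eq
  refine Set.Infinite.mono (s := {T : ℚ | ¬ (LD * PD * tD).IsRoot T}) (fun T hT => ?_)
    (Polynomial.finite_setOf_isRoot hG).infinite_compl
  -- at a non-root `T` the function identity can be cross-multiplied
  have hT' : eval T (LD * PD * tD) ≠ 0 := hT
  rw [eval_mul, eval_mul] at hT'
  have hT1 : eval T LD ≠ 0 := fun h => hT' (by rw [h, zero_mul, zero_mul])
  have hT2 : eval T PD ≠ 0 := fun h => hT' (by rw [h, mul_zero, zero_mul])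
  have hT3 : eval T tD ≠ 0 := fun h => hT' (by rw [h, mul_zero])
  show eval T _ = eval T _
  have hfun := topFun_frobenius (K := ℚ) hAB ε hp.pos hpQ hK (-(K : ℚ) + T)
  have e1 : topFun A B ε (n * p) (K * p) ((p : ℚ) * (-(K : ℚ) + T)) =
      ((taylor (-((K * p : ℕ) : ℚ)) (kerNum A B ε (n * p))).comp (C (p : ℚ) * X)).eval T / LD.eval T := by
    rw [topFun_eq_div, hLD, eval_comp, eval_comp, eval_mul, eval_C, eval_X, taylor_eval, taylor_eval]
    congr 2 <;> (push_cast; ring)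
  have e2 : brickPhi A B p n (-(K : ℚ) + T) =
      ((phiNum A B p n K).map (Int.castRingHom ℚ)).eval T / PD.eval T := by
    rw [hPD, ← aeval_eq_eval_map, ← aeval_eq_eval_map, ← brickPhi_neg_add_eq hp h2, Int.cast_natCast]
  have e3 : topFun A B ε n K (-(K : ℚ) + T) = (taylor (-(K : ℚ)) (kerNum A B ε n)).eval T / tD.eval T := by
    rw [topFun_eq_div, htD, taylor_eval, taylor_eval, add_comm]
  rw [e1, e2, e3, div_eq_iff hT1] at hfun
  rw [eval_mul, eval_mul, hfun, eval_mul, eval_mul, eval_mul, eval_C]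
  field_simp

/-- **(B1) as an identity of power series**: `rescale_p(F^{(np)}_{Kp}) = p^ε · Φ_{n,p}(−K+·) · F^{(n)}_K` in `ℚ⟦T⟧`,
i.e. `F^{(np)}_{Kp}(pT) = p^ε·Φ_{n,p}(−K+T)·F^{(n)}_K(T)`. -/
theorem laurentSeries_frobenius :
    PowerSeries.rescale (p : ℚ) (laurentSeries A B ε (n * p) (K * p)) =
      PowerSeries.C ((p : ℚ) ^ ε) * phiSeries A B p n K * laurentSeries A B ε n K := by
  have hpoly := congrArg (fun P : ℚ[X] => (P : PowerSeries ℚ)) (frobenius_poly hp h2 hAB ε hK)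
  simp only [Polynomial.coe_mul, coe_comp_C_mul_X, Polynomial.coe_C] at hpoly
  -- names for the six series
  set LN := PowerSeries.rescale (p : ℚ) ((taylor (-((K * p : ℕ) : ℚ)) (kerNum A B ε (n * p)) : ℚ[X]) :
    PowerSeries ℚ) with hLN
  set LD := PowerSeries.rescale (p : ℚ) ((taylor (-((K * p : ℕ) : ℚ)) (kerDenErase A (n * p) (K * p)) : ℚ[X]) :
    PowerSeries ℚ) with hLD
  set PN := (((phiNum A B p n K).map (Int.castRingHom ℚ) : ℚ[X]) : PowerSeries ℚ) with hPN
  set PD := (((phiDen A p n K).map (Int.castRingHom ℚ) : ℚ[X]) : PowerSeries ℚ) with hPD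
  set tN := ((taylor (-(K : ℚ)) (kerNum A B ε n) : ℚ[X]) : PowerSeries ℚ) with htN
  set tD := ((taylor (-(K : ℚ)) (kerDenErase A n K) : ℚ[X]) : PowerSeries ℚ) with htD
  have hLD0 : PowerSeries.constantCoeff LD ≠ 0 := by
    rw [hLD, ← PowerSeries.coeff_zero_eq_constantCoeff_apply, PowerSeries.coeff_rescale, pow_zero, one_mul,
      PowerSeries.coeff_zero_eq_constantCoeff_apply, constantCoeff_coe_taylor]
    exact eval_kerDenErase_neg_ne_zero A (n * p) (K * p)
  have hPD0 : PowerSeries.constantCoeff PD ≠ 0 := by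
    rw [hPD, Polynomial.constantCoeff_coe, coeff_zero_eq_eval_zero]
    exact eval_phiDen_zero_ne_zero A p n K
  have htD0 : PowerSeries.constantCoeff tD ≠ 0 := by
    rw [htD, constantCoeff_coe_taylor]; exact eval_kerDenErase_neg_ne_zero A n K
  have hL : PowerSeries.rescale (p : ℚ) (laurentSeries A B ε (n * p) (K * p)) = LN * LD⁻¹ := by
    rw [laurentSeries, expandAt, map_mul, rescale_inv _ (by
      rw [constantCoeff_coe_taylor]; exact eval_kerDenErase_neg_ne_zero A (n * p) (K * p))]
  have hΦ : phiSeries A B p n K = PN * PD⁻¹ := by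
    rw [phiSeries, expandAt, taylor_zero, taylor_zero]
  have hR : laurentSeries A B ε n K = tN * tD⁻¹ := rfl
  rw [hL, hΦ, hR]
  -- cancel the invertible product `LD · PD · tD`
  have hne : LD * PD * tD ≠ 0 := by
    refine mul_ne_zero (mul_ne_zero ?_ ?_) ?_ <;> intro h <;> [apply hLD0; apply hPD0; apply htD0] <;>
      rw [h, map_zero]
  apply mul_right_cancel₀ hne
  calc LN * LD⁻¹ * (LD * PD * tD) = LN * PD * tD * (LD⁻¹ * LD) := by ring
    _ = LN * PD * tD := by rw [PowerSeries.inv_mul_cancel _ hLD0, mul_one]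
    _ = PowerSeries.C ((p : ℚ) ^ ε) * LD * PN * tN := hpoly
    _ = PowerSeries.C ((p : ℚ) ^ ε) * LD * PN * tN * (PD⁻¹ * PD) * (tD⁻¹ * tD) := by
        rw [PowerSeries.inv_mul_cancel _ hPD0, PowerSeries.inv_mul_cancel _ htD0, mul_one, mul_one]
    _ = PowerSeries.C ((p : ℚ) ^ ε) * (PN * PD⁻¹) * (tN * tD⁻¹) * (LD * PD * tD) := by ring

/-- **(B1) at every depth** (zi-p2 THEOREM 5/6 Step B, PLAN-T7 (★) at `g = 0`): for an odd prime `p`, `2B ≤ A`,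
`K ≤ n` and every `d`:  `p^d · laurent(np, Kp, d) = p^ε · Σ_{m+e=d} φ_m · laurent(n, K, e)`. -/
theorem laurent_frobenius (d : ℕ) :
    (p : ℚ) ^ d * laurent A B ε (n * p) (K * p) d =
      (p : ℚ) ^ ε * ∑ x ∈ antidiagonal d, phiCoeff A B p n K x.1 * laurent A B ε n K x.2 := by
  have h := congrArg (PowerSeries.coeff d) (laurentSeries_frobenius hp h2 hAB ε hK)
  rw [PowerSeries.coeff_rescale, mul_assoc, PowerSeries.coeff_C_mul, PowerSeries.coeff_mul] at h
  simpa only [laurent, phiCoeff] using h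

/-- **(B1) in zi-p2's indexing** (`1 ≤ s ≤ A`): `p^{A−s} · c_{Kp,s}(np) = p^ε · Σ_{m=0}^{A−s} φ_m · c_{K,s+m}(n)`;
for `ε = 1` this is `p^{τ_s}c_{jp,s}(np) = Σ_{m=0}^{A−s}φ_m c_{j,s+m}(n)` with `τ_s = A−1−s` (THEOREM6.md (B1)). -/
theorem cell_frobenius (s : ℕ) :
    (p : ℚ) ^ (A - s) * cell A B ε (n * p) (K * p) s =
      (p : ℚ) ^ ε * ∑ m ∈ range (A - s + 1), phiCoeff A B p n K m * cell A B ε n K (s + m) := by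
  rw [cell, laurent_frobenius hp h2 hAB ε hK (A - s), Finset.Nat.sum_antidiagonal_eq_sum_range_succ_mk]
  congr 1
  refine Finset.sum_congr rfl fun m _ => ?_
  rw [cell, Nat.sub_add_eq]

end frobenius

/-- Sanity instance (smallest brick `(A,B,ε) = (2,1,0)`, `n = K = 0`): `laurent 2 1 0 0 0 0 = cTop 2 1 0 0 0`. -/
example : laurent 2 1 0 0 0 0 = cTop 2 1 0 0 0 := laurent_zero (by norm_num) 0 le_rfl

end

end Summit.KontsevichZagierPeriods.Zeta5Search.BrickLaurent
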